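import Summits.BirchSwinnertonDyer.BirchSwinnertonDyer.Theorems.ResidualThetaTransportAtTwoSignedMuSeedAtTwoPlusPrimLayerZeroLocal
import Summits.BirchSwinnertonDyer.BirchSwinnertonDyer.Theorems.ResidualThetaTransportAtTwoSignedMuSeedAtTwoPlusLayerZeroExact
import Literature.NumberTheory.EllipticCurves.Kobayashi2003.SignedSelmerRankBoundProofs
import Literature.NumberTheory.EllipticCurves.FineSelmerCoefficientMapProofs
import Literature.NumberTheory.EllipticCurves.AnticyclotomicSignedSelmer
import HarnessLib

/-!
# Line `norm-one-torus` of the crux `SignedMuSeedAtTwoPlus` (stmt-BirchSwinnertonDyer-21438; = `stub_residualSeedAtTwo` of Kμ⁺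
# stmt-BirchSwinnertonDyer-20689 BY NAME): the `q = 1` certificate is a statement OVER `ℚ` — the `2`-adic signed-plus condition of a
# layer-`0` class read over `ℚ_∞` is the CLASSICAL Kummer condition at `2` over `ℚ_0` (HONDA⁺@2 / INJ⁺@2, unconditional tree theorems)
# (width seat bsd-wall-rtt-p4-w3 g6; `--supports stmt-BirchSwinnertonDyer-21438`; closes nothing)

HONEST FRAMING. THEOREMS ONLY (no `def`, no named fact, no `sorry`); nothing about any particular curve is asserted; BSD is not
proved by any of this. Completes the layer-`0` reading of this seat's `…PrimLayerZero` (p609373) / `…PrimLayerZeroLocal`: ALL THREE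
local conditions of `R₀` are now conditions over `ℚ_0 = ℚ`.

For `W/ℚ` globally minimal, good supersingular at `2` with `a₂ = 0`, `κ` cyclotomic with topological generator `γ`, `v ∣ 2`,
`k₀ : H¹(ℚ_0, W[2^∞][2]) → H¹(ℚ_0, W[2^∞])` and `k_∞`, `res`, `h_0` the Kummer / restriction maps (`h_0 ∘ k₀ = k_∞ ∘ res`,
`layerToInfty_pushH1_eq`):
* `§1` `signedKummer_resOfLe_of_mem_localKerOver` — (c₀) ⇒ (c): if `k₀ c₀` satisfies the CLASSICAL local condition at `v` over `ℚ_0`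
  (`localKerOver`), then every conjugate of `k_∞ (res c₀)` satisfies Kobayashi's signed-plus Kummer condition over `ℚ_∞`
  (`E(ℚ_{0,v}) = E⁺(ℚ_{0,v}) ≤ ⨆ₙ E⁺(ℚ_{n,v})`; tree `localKerOverOfEmb_le_localKummerOverOfEmb_fixedPoints`, `signedLocalPointsOfEmb_zero`,
  `AcSigned.map_resOfLe_localKummerOverOfEmb_le`). Any `W`, any `κ`.
* `§2` `mem_localKerOver_of_residual` — (a) ∧ (b) ∧ (c) for `res c₀` ⇒ (c₀): `k_∞ (res c₀) ∈ Sel⁺(W/ℚ_∞)`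
  (`Sel2TransferAtTwo.pushH1_mem_signedSelmerInfty_of_mem_residualSharp_empty`), so `k₀ c₀ ∈ h_0⁻¹(Sel⁺_∞)` and INJ⁺@2
  (`SignedMuAtTwo.LayerZero.plusLocalInj_two`, HONDA⁺@2 unconditional) gives the classical condition at `v`.
* `§3` **`primCertificate_one_iff_classical`** — `PrimCertificate W κ γ 1` (unfolded) **iff** every `c₀ ∈ H¹(ℚ_0, W[2^∞][2])` that is
  unramified at every odd place, locally trivial at `∞`, and whose `2^∞`-Kummer image is classically Selmer at the place over `2`
  — all over `ℚ_0` — vanishes. With `isTorsion_and_mu_eq_zero_of_classical`: this residual `2`-descent condition at ONE curve gives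
  μ⁺ = 0 ∧ torsion for every finitely generated `+` signed Selmer dual of that curve at `(κ, γ)`.

References: [Kobayashi2003] Def. 1.1, §8.4, Thm. 9.3; [GreenbergLNM1716] §2, §3 Lemmas 3.1–3.2; [BDKim2013] proof of Cor. 3.15;
[GreenbergVatsal2000] §2, Prop. (2.8); [Fukuda1994] Thm. 1.
-/

set_option autoImplicit false
-- D-0017: single-problem summit, so `Summit.BirchSwinnertonDyer.BirchSwinnertonDyer.…` repeats a namespace BY DESIGN.
set_option linter.dupNamespace false

noncomputable section

open scoped Classical AddSubgroup

open WeierstrassCurve NumberField IsDedekindDomain Literature Literature.NumberTheory.EllipticCurves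
  Literature.NumberTheory.GaloisRepresentations Literature.NumberTheory.EllipticCurves.GreenbergVatsal2000
  Literature.NumberTheory.EllipticCurves.Kobayashi2003 ZpExtension
  Literature.NumberTheory.EllipticCurves.GreenbergSelmer
  Literature.NumberTheory.EllipticCurves.Rank1Residual Literature.NumberTheory.EllipticCurves.IwasawaAlgebra
  Summit.BirchSwinnertonDyer.BirchSwinnertonDyer.Theorems.SignedTransportAtTwo
  Summit.BirchSwinnertonDyer.BirchSwinnertonDyer.Theorems.Sel2TransferAtTwo

namespace Summit.BirchSwinnertonDyer.BirchSwinnertonDyer.Theorems.SignedMuAtTwo.NormOneTorus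

universe u

/-! ## §0. `h_0 ∘ k₀ = k_∞ ∘ res`; `Γ_{ℚ_0}` is compact -/

section Naturality

variable (W : WeierstrassCurve ℚ) [W.IsElliptic]

omit [W.IsElliptic] in
/-- **`h_0 (k₀ c₀) = k_∞ (res c₀)`**: the `2^∞`-Kummer maps commute with restriction from `ℚ_0` to `ℚ_∞`.
[cite: SerreGaloisCohomology1997, I.§2.4] -/
theorem layerToInfty_pushH1_eq (κ : ZpExtension ℚ 2)
    (c₀ : subgroupH1 (κ.layerSubgroup 0) ↥((↥(W.geomPrimaryTorsion 2))[(2 : ℤ)])) :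
    W.layerToInfty κ 0 (pushH1 (κ.layerSubgroup 0) ((↥(W.geomPrimaryTorsion 2))[(2 : ℤ)]).subtype (subtype_torsionBy_smul W 2) c₀) =
      pushH1 κ.kerSubgroup ((↥(W.geomPrimaryTorsion 2))[(2 : ℤ)]).subtype (subtype_torsionBy_smul W 2)
        (Literature.NumberTheory.EllipticCurves.resOfLe ↥((↥(W.geomPrimaryTorsion 2))[(2 : ℤ)]) (κ.kerSubgroup_le_layerSubgroup 0) c₀) := by
  have h := DFunLike.congr_fun (FineSelmerCoefficientMap.resOfLe_comp_resH1Hom_id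
    (M := ↥((↥(W.geomPrimaryTorsion 2))[(2 : ℤ)])) (M' := ↥(W.geomPrimaryTorsion 2)) (κ.kerSubgroup_le_layerSubgroup 0)
    ((↥(W.geomPrimaryTorsion 2))[(2 : ℤ)]).subtype (fun h x ↦ subtype_torsionBy_smul W 2 h x)
    (fun h x ↦ subtype_torsionBy_smul W 2 h x)) c₀
  simp only [AddMonoidHom.coe_comp, Function.comp_apply] at h
  -- `layerToInfty κ 0 = resOfLe (E[2^∞]) (ker κ ≤ Γ_{ℚ_0})` by definition
  exact h

omit [W.IsElliptic] in
/-- `Γ_{ℚ_0}` (an open subgroup of the profinite `Γ_ℚ`) is compact. [folklore] -/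
theorem compactSpace_layerSubgroup_zero (κ : ZpExtension ℚ 2) : CompactSpace (κ.layerSubgroup 0) := by
  haveI : CompactSpace (Field.absoluteGaloisGroup ℚ) := compactSpace_absoluteGaloisGroup ℚ
  exact isCompact_iff_compactSpace.mp (Subgroup.isClosed_of_isOpen _ (κ.isOpen_layerSubgroup 0)).isCompact

end Naturality

/-! ## §1. (c₀) ⇒ (c): classical at `2` over `ℚ_0` ⇒ signed-plus over `ℚ_∞` -/

section Up

variable (W : WeierstrassCurve ℚ) [W.IsElliptic]

omit [W.IsElliptic] in
/-- **(c₀) ⇒ (c).** If the `2^∞`-Kummer image `k₀ c₀` of `c₀ ∈ H¹(ℚ_0, W[2^∞][2])` satisfies the classical local condition at the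
place `v ∣ 2` over `ℚ_0` (it dies in `H¹(ℚ_{0,v}, E)`), then every conjugate of `k_∞ (res c₀)` satisfies Kobayashi's signed-plus
Kummer condition at `v` over `ℚ_∞` w.r.t. `⨆ₙ E⁺(ℚ_{n,v})`: a class dying in `H¹(ℚ_v, E)` is the Kummer class of a point of
`E(ℚ_v) = E⁺(ℚ_{0,v})` (`localKerOverOfEmb_le_localKummerOverOfEmb_fixedPoints`, `signedLocalPointsOfEmb_zero`), restriction to `ℚ_∞`
keeps Kummer witnesses (`AcSigned.map_resOfLe_localKummerOverOfEmb_le`), `E⁺_0 ≤ ⨆ₙ E⁺_n`, and conjugation fixes classes restricted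
from `ℚ_0`. Any `W`, any `ℤ₂`-extension `κ`. [cite: Kobayashi2003, Def. 1.1 (p. 2)] [cite: GreenbergLNM1716, §2] -/
theorem signedKummer_resOfLe_of_mem_localKerOver (κ : ZpExtension ℚ 2)
    (c₀ : subgroupH1 (κ.layerSubgroup 0) ↥((↥(W.geomPrimaryTorsion 2))[(2 : ℤ)]))
    (v : HeightOneSpectrum (𝓞 ℚ))
    (h0 : pushH1 (κ.layerSubgroup 0) ((↥(W.geomPrimaryTorsion 2))[(2 : ℤ)]).subtype (subtype_torsionBy_smul W 2) c₀ ∈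
      W.localKerOver 2 (κ.layerSubgroup 0) (v.adicCompletion ℚ))
    (σ : Field.absoluteGaloisGroup ℚ) :
    W.conjH1 2 κ.kerSubgroup σ
        (pushH1 κ.kerSubgroup ((↥(W.geomPrimaryTorsion 2))[(2 : ℤ)]).subtype (subtype_torsionBy_smul W 2)
          (Literature.NumberTheory.EllipticCurves.resOfLe ↥((↥(W.geomPrimaryTorsion 2))[(2 : ℤ)])
            (κ.kerSubgroup_le_layerSubgroup 0) c₀)) ∈
      localKummerOverOfEmb W 2 κ.kerSubgroup (closureEmb (K := ℚ) (v.adicCompletion ℚ))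
        (⨆ n : ℕ, signedLocalPoints κ (v.adicCompletion ℚ) W 1 n) := by
  set M : Type := ↥((↥(W.geomPrimaryTorsion 2))[(2 : ℤ)]) with hM
  set ι := closureEmb (K := ℚ) (v.adicCompletion ℚ) with hι
  set k₀ := pushH1 (κ.layerSubgroup 0) ((↥(W.geomPrimaryTorsion 2))[(2 : ℤ)]).subtype (subtype_torsionBy_smul W 2) with hk₀
  set kW := pushH1 κ.kerSubgroup ((↥(W.geomPrimaryTorsion 2))[(2 : ℤ)]).subtype (subtype_torsionBy_smul W 2) with hkW
  set res := Literature.NumberTheory.EllipticCurves.resOfLe M (κ.kerSubgroup_le_layerSubgroup 0) with hres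
  -- conjugation fixes the restricted class
  have hconj : W.conjH1 2 κ.kerSubgroup σ (kW (res c₀)) = kW (res c₀) := by
    rw [show W.conjH1 2 κ.kerSubgroup σ (kW (res c₀)) =
        kW (Literature.NumberTheory.EllipticCurves.conjH1 κ.kerSubgroup M σ (res c₀)) from
      (pushH1_conjH1 κ.kerSubgroup ((↥(W.geomPrimaryTorsion 2))[(2 : ℤ)]).subtype (subtype_torsionBy_smul W 2) σ (res c₀)).symm,
      conjH1_resOfLe_layerZero W κ σ c₀]
  rw [hconj, ← layerToInfty_pushH1_eq W κ c₀]
  -- `k₀ c₀` is the Kummer class of a point of `E(ℚ_{0,v}) = E⁺_0`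
  haveI : CompactSpace (κ.layerSubgroup 0) := compactSpace_layerSubgroup_zero κ
  have h1 : k₀ c₀ ∈ localKummerOverOfEmb W 2 (κ.layerSubgroup 0) ι (signedLocalPoints κ (v.adicCompletion ℚ) W 1 0) := by
    rw [signedLocalPoints, signedLocalPointsOfEmb_zero]
    rw [WeierstrassCurve.localKerOver_eq_ofEmb] at h0
    exact localKerOverOfEmb_le_localKummerOverOfEmb_fixedPoints W 2 (κ.layerSubgroup 0) ι h0
  -- restriction to `ℚ_∞` keeps the Kummer witness; `E⁺_0 ≤ ⨆ₙ E⁺_n`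
  have h2 : W.layerToInfty κ 0 (k₀ c₀) ∈
      localKummerOverOfEmb W 2 κ.kerSubgroup ι (signedLocalPoints κ (v.adicCompletion ℚ) W 1 0) :=
    AcSigned.map_resOfLe_localKummerOverOfEmb_le W 2 ι (κ.kerSubgroup_le_layerSubgroup 0) _ ⟨k₀ c₀, h1, rfl⟩
  exact localKummerOverOfEmb_mono (le_iSup (fun n : ℕ ↦ signedLocalPoints κ (v.adicCompletion ℚ) W 1 n) 0) h2

end Up

/-! ## §2. (a) ∧ (b) ∧ (c) ⇒ (c₀): signed-plus over `ℚ_∞` ⇒ classical at `2` over `ℚ_0` (INJ⁺@2) -/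

section Down

variable (W : WeierstrassCurve ℚ) [W.IsElliptic] [W.IsGloballyMinimal]

/-- **(a) ∧ (b) ∧ (c) ⇒ (c₀).** For `W` globally minimal, good supersingular at `2` with `a₂ = 0`, `κ` cyclotomic: if the restriction
`res c₀` of `c₀ ∈ H¹(ℚ_0, W[2^∞][2])` is primitive residual signed-plus over `ℚ_∞` ((a) unramified at every odd place, (b) residually
trivial at `∞`, (c) signed-plus at `2`), then `k₀ c₀` satisfies the CLASSICAL local condition at every `v ∣ 2` over `ℚ_0`:
`k_∞ (res c₀) ∈ Sel⁺(W/ℚ_∞)` (`pushH1_mem_signedSelmerInfty_of_mem_residualSharp_empty`), so `k₀ c₀ ∈ h_0⁻¹(Sel⁺_∞)`, and INJ⁺@2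
(`LayerZero.plusLocalInj_two`: HONDA⁺@2, unconditional). [cite: Kobayashi2003, §8.4 and Thm. 9.3] [cite: BDKim2013, proof of Cor. 3.15]
[cite: GreenbergVatsal2000, Prop. (2.8)] -/
theorem mem_localKerOver_of_residual (hss : GoodSS W 2) (ha2 : W.frobeniusTrace 2 = 0) (κ : ZpExtension ℚ 2)
    (hκ : κ.IsCyclotomic) (c₀ : subgroupH1 (κ.layerSubgroup 0) ↥((↥(W.geomPrimaryTorsion 2))[(2 : ℤ)]))
    (ha : Literature.NumberTheory.EllipticCurves.resOfLe ↥((↥(W.geomPrimaryTorsion 2))[(2 : ℤ)]) (κ.kerSubgroup_le_layerSubgroup 0) c₀ ∈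
      unramifiedOutside κ.kerSubgroup ↥((↥(W.geomPrimaryTorsion 2))[(2 : ℤ)]) 2 (∅ : Set (HeightOneSpectrum (𝓞 ℚ))))
    (hb : ∀ (w : InfinitePlace ℚ) (σ : Field.absoluteGaloisGroup ℚ),
      Literature.NumberTheory.EllipticCurves.conjH1 κ.kerSubgroup ↥((↥(W.geomPrimaryTorsion 2))[(2 : ℤ)]) σ
          (Literature.NumberTheory.EllipticCurves.resOfLe ↥((↥(W.geomPrimaryTorsion 2))[(2 : ℤ)])
            (κ.kerSubgroup_le_layerSubgroup 0) c₀) ∈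
        GreenbergSelmer.infKer κ.kerSubgroup ↥((↥(W.geomPrimaryTorsion 2))[(2 : ℤ)]) w)
    (hc : ∀ (v : HeightOneSpectrum (𝓞 ℚ)), ((2 : ℕ) : 𝓞 ℚ) ∈ v.asIdeal → ∀ σ : Field.absoluteGaloisGroup ℚ,
      W.conjH1 2 κ.kerSubgroup σ
          (pushH1 κ.kerSubgroup ((↥(W.geomPrimaryTorsion 2))[(2 : ℤ)]).subtype (subtype_torsionBy_smul W 2)
            (Literature.NumberTheory.EllipticCurves.resOfLe ↥((↥(W.geomPrimaryTorsion 2))[(2 : ℤ)])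
              (κ.kerSubgroup_le_layerSubgroup 0) c₀)) ∈
        localKummerOverOfEmb W 2 κ.kerSubgroup (closureEmb (K := ℚ) (v.adicCompletion ℚ))
          (⨆ n : ℕ, signedLocalPoints κ (v.adicCompletion ℚ) W 1 n))
    (v : HeightOneSpectrum (𝓞 ℚ)) (hv : ((2 : ℕ) : 𝓞 ℚ) ∈ v.asIdeal) :
    pushH1 (κ.layerSubgroup 0) ((↥(W.geomPrimaryTorsion 2))[(2 : ℤ)]).subtype (subtype_torsionBy_smul W 2) c₀ ∈
      W.localKerOver 2 (κ.layerSubgroup 0) (v.adicCompletion ℚ) := by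
  -- `k_∞ (res c₀) ∈ Sel⁺(W/ℚ_∞)`
  have hsel := pushH1_mem_signedSelmerInfty_of_mem_residualSharp_empty W κ hκ ha hb hc
  -- hence `k₀ c₀ ∈ h_0⁻¹(Sel⁺_∞)`
  have hmem : pushH1 (κ.layerSubgroup 0) ((↥(W.geomPrimaryTorsion 2))[(2 : ℤ)]).subtype (subtype_torsionBy_smul W 2) c₀ ∈
      (signedSelmerInfty W κ 1).comap (W.layerToInfty κ 0) := by
    rw [AddSubgroup.mem_comap, layerToInfty_pushH1_eq W κ c₀]
    exact hsel
  -- INJ⁺@2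
  have hv' : (2 : 𝓞 ℚ) ∈ v.asIdeal := by exact_mod_cast hv
  exact (W.mem_localKerOver_iff 2 (κ.layerSubgroup 0) _ _).mpr
    (LayerZero.plusLocalInj_two W hss ha2 hκ v hv' _ hmem)

end Down

/-! ## §3. The `q = 1` certificate as a statement over `ℚ` -/

section Classical

variable (W : WeierstrassCurve ℚ) [W.IsElliptic] [W.IsGloballyMinimal]

/-- **`PrimCertificate W κ γ 1` ⟺ the primitive residual `2`-descent set `R₀ ⊆ H¹(ℚ_0, W[2^∞][2])` is trivial.** For `W/ℚ` globally
minimal, good supersingular at `2` with `a₂ = 0`, `κ` cyclotomic with topological generator `γ`: the `q = 1` member-free layer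
certificate of line `norm-one-torus` (its local definitions unfolded) holds iff every class `c₀ ∈ H¹(ℚ_0, W[2^∞][2])` which is
(a₀) unramified at every odd place, (b₀) locally trivial at `∞`, and (c₀) whose `2^∞`-Kummer image `k₀ c₀` satisfies the CLASSICAL
local (Kummer) condition at the place above `2` — all three over `ℚ_0 = ℚ` — vanishes. (`primCertificate_one_iff_layerZero_local` with
the `2`-adic condition moved down by §§1–2.) [cite: GreenbergLNM1716, §3 Lemmas 3.1–3.2 (PDF p. 86)] [cite: Kobayashi2003, Def. 1.1 and Thm. 9.3]
[cite: Fukuda1994, Thm. 1] -/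
theorem primCertificate_one_iff_classical (hss : GoodSS W 2) (ha2 : W.frobeniusTrace 2 = 0) (κ : ZpExtension ℚ 2)
    (hκ : κ.IsCyclotomic) (γ : Field.absoluteGaloisGroup ℚ) (hγ : κ.IsTopGenerator γ) :
    (∃ F : Finset (subgroupH1 κ.kerSubgroup ↥((↥(W.geomPrimaryTorsion 2))[(2 : ℤ)])),
        (∀ c, c ∈ F ↔ (c ∈
          {c : subgroupH1 κ.kerSubgroup ↥((↥(W.geomPrimaryTorsion 2))[(2 : ℤ)]) |
            c ∈ unramifiedOutside κ.kerSubgroup ↥((↥(W.geomPrimaryTorsion 2))[(2 : ℤ)]) 2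
                  (∅ : Set (HeightOneSpectrum (𝓞 ℚ))) ∧
              (∀ (w : InfinitePlace ℚ) (σ : Field.absoluteGaloisGroup ℚ),
                Literature.NumberTheory.EllipticCurves.conjH1 κ.kerSubgroup ↥((↥(W.geomPrimaryTorsion 2))[(2 : ℤ)]) σ c ∈
                  GreenbergSelmer.infKer κ.kerSubgroup ↥((↥(W.geomPrimaryTorsion 2))[(2 : ℤ)]) w) ∧
              (∀ (v : HeightOneSpectrum (𝓞 ℚ)), ((2 : ℕ) : 𝓞 ℚ) ∈ v.asIdeal → ∀ σ : Field.absoluteGaloisGroup ℚ,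
                W.conjH1 2 κ.kerSubgroup σ
                    (pushH1 κ.kerSubgroup ((↥(W.geomPrimaryTorsion 2))[(2 : ℤ)]).subtype (subtype_torsionBy_smul W 2) c) ∈
                  localKummerOverOfEmb W 2 κ.kerSubgroup (closureEmb (K := ℚ) (v.adicCompletion ℚ))
                    (⨆ n : ℕ, signedLocalPoints κ (v.adicCompletion ℚ) W 1 n))} ∧
          ((@HSub.hSub (AddMonoid.End (subgroupH1 κ.kerSubgroup ↥((↥(W.geomPrimaryTorsion 2))[(2 : ℤ)])))
              (AddMonoid.End (subgroupH1 κ.kerSubgroup ↥((↥(W.geomPrimaryTorsion 2))[(2 : ℤ)])))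
              (AddMonoid.End (subgroupH1 κ.kerSubgroup ↥((↥(W.geomPrimaryTorsion 2))[(2 : ℤ)]))) instHSub
              (Literature.NumberTheory.EllipticCurves.conjH1 κ.kerSubgroup ↥((↥(W.geomPrimaryTorsion 2))[(2 : ℤ)]) γ) 1) ^
            1) c = 0)) ∧
        F.card < 2 ^ 1) ↔
    (∀ c₀ : subgroupH1 (κ.layerSubgroup 0) ↥((↥(W.geomPrimaryTorsion 2))[(2 : ℤ)]),
      c₀ ∈ unramifiedOutside (κ.layerSubgroup 0) ↥((↥(W.geomPrimaryTorsion 2))[(2 : ℤ)]) 2 (∅ : Set (HeightOneSpectrum (𝓞 ℚ))) →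
      (∀ w : InfinitePlace ℚ, c₀ ∈ GreenbergSelmer.infKer (κ.layerSubgroup 0) ↥((↥(W.geomPrimaryTorsion 2))[(2 : ℤ)]) w) →
      (∀ v : HeightOneSpectrum (𝓞 ℚ), ((2 : ℕ) : 𝓞 ℚ) ∈ v.asIdeal →
          pushH1 (κ.layerSubgroup 0) ((↥(W.geomPrimaryTorsion 2))[(2 : ℤ)]).subtype (subtype_torsionBy_smul W 2) c₀ ∈
            W.localKerOver 2 (κ.layerSubgroup 0) (v.adicCompletion ℚ)) →
      c₀ = 0) := by
  rw [primCertificate_one_iff_layerZero_local W hss κ γ hγ]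
  refine forall_congr' fun c₀ ↦ ⟨fun h ha hb hc ↦ h ha hb fun v hv σ ↦ ?_, fun h ha hb hc ↦ h ha hb fun v hv ↦ ?_⟩
  · exact signedKummer_resOfLe_of_mem_localKerOver W κ c₀ v (hc v hv) σ
  · exact mem_localKerOver_of_residual W hss ha2 κ hκ c₀ ((resOfLe_mem_unramifiedOutside_iff W κ c₀).mpr ha)
      ((forall_conjH1_resOfLe_mem_infKer_iff W κ c₀).mpr hb) hc v hv

/-- **Per-curve door, classical form.** For `W/ℚ` globally minimal, good supersingular at `2` with `a₂ = 0`, `Δ_W < 0`, `κ` cyclotomic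
with topological generator `γ`: if the primitive residual `2`-descent set over `ℚ` vanishes — no non-zero `c₀ ∈ H¹(ℚ_0, W[2^∞][2])`
is unramified at all odd places, locally trivial at `∞`, with `k₀ c₀` classically Selmer at the place over `2` — then every finitely
generated `+` signed Selmer dual of `W` at `(κ, γ)` is `Λ`-torsion with `μ = 0`.
[cite: GreenbergLNM1716, §3 Lemma 3.2 (PDF p. 86)] [cite: Fukuda1994, Thm. 1] [cite: Kobayashi2003, Def. 1.1 and Thm. 9.3] -/
theorem isTorsion_and_mu_eq_zero_of_classical (hss : GoodSS W 2) (ha2 : W.frobeniusTrace 2 = 0) (hΔ : W.Δ < 0)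
    (κ : ZpExtension ℚ 2) (γ : Field.absoluteGaloisGroup ℚ) (hκ : κ.IsCyclotomic) (hγ : κ.IsTopGenerator γ)
    (h0 : ∀ c₀ : subgroupH1 (κ.layerSubgroup 0) ↥((↥(W.geomPrimaryTorsion 2))[(2 : ℤ)]),
      c₀ ∈ unramifiedOutside (κ.layerSubgroup 0) ↥((↥(W.geomPrimaryTorsion 2))[(2 : ℤ)]) 2 (∅ : Set (HeightOneSpectrum (𝓞 ℚ))) →
      (∀ w : InfinitePlace ℚ, c₀ ∈ GreenbergSelmer.infKer (κ.layerSubgroup 0) ↥((↥(W.geomPrimaryTorsion 2))[(2 : ℤ)]) w) →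
      (∀ v : HeightOneSpectrum (𝓞 ℚ), ((2 : ℕ) : 𝓞 ℚ) ∈ v.asIdeal →
          pushH1 (κ.layerSubgroup 0) ((↥(W.geomPrimaryTorsion 2))[(2 : ℤ)]).subtype (subtype_torsionBy_smul W 2) c₀ ∈
            W.localKerOver 2 (κ.layerSubgroup 0) (v.adicCompletion ℚ)) →
      c₀ = 0)
    (D : SignedSelmerDualData W κ γ 1) [Module.Finite (IwasawaAlgebra 2) D.X] :
    Module.IsTorsion (IwasawaAlgebra 2) D.X ∧ D.mu = 0 :=
  isTorsion_and_mu_eq_zero_of_primCertificate W hss hΔ κ γ hκ hγ 1 le_rfl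
    ((primCertificate_one_iff_classical W hss ha2 κ hκ γ hγ).mpr h0) D

end Classical

end Summit.BirchSwinnertonDyer.BirchSwinnertonDyer.Theorems.SignedMuAtTwo.NormOneTorus

end
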